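import Summits.AtomisticToContinuum.HydrodynamicLimit.Theses.EnskogAdjointDuality
import HarnessLib

/-!
# EnskogAdjointDuality — the velocity-cutoff repair K2R′ of the sibling crux `AdjointEnskogTestFamilyR` (definitions)

Support file for the crux `Summit.AtomisticToContinuum.HydrodynamicLimit.Theses.EnskogAdjointDuality.CollisionResidualVanishes`
(K1, stmt-AtomisticToContinuum-14658, line `birth`, lead c7, 2026-08-17) and for the planner's joint restate of the route
`EnskogAdjointDuality`. The sibling crux `AdjointEnskogTestFamilyR` (K2R, stmt-AtomisticToContinuum-11592) is false AS
TYPED (`Cruxes/AdjointEnskogTestFamilyR/HyperVelocityObstruction.md`, 2026-08-17: its property (iii), the defect bound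
`|Dφ^N + L^Nφ^N| ≤ η_N(1+|v|²)` for ALL `v ∈ ℝ³`, is unsatisfiable in the admissible class — isotropic log cascade at
hyper-velocities `|v| ≍ λ_N e^{O(λ_N)}`). Its minimal repair R1 (§9 there) asks (iii) only below the velocity cutoff
`‖v‖ ≤ N + 1` and adds a crude global polynomial defect bound `|Dφ^N + L^Nφ^N| ≤ C_g(1+|v|²)³`. This file DECLARES that
repair as route-internal Props (not cited facts), in the SAME cutoff syntax as the K1-side candidate
`CollisionResidualVanishesDualCutAt` of `…CollisionResidualVanishesCutDefs.lean` (lead c6), so that the two plug into each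
other with no glue:

* `AdjointEnskogTestFamilyRCutAt η₁` — the body of the route decl `AdjointEnskogTestFamilyR` after its EOS-window prefix,
  verbatim, EXCEPT that the clause (ii)∧(iii) `∃ η_N → 0, ∀ᶠ N, (C¹ along free flight) ∧ (defect ≤ η_N(1+|v|²) ∀ v)` is
  replaced by `∃ η_N → 0, ∃ C_g, ∀ᶠ N, (C¹ along free flight) ∧ (defect ≤ η_N(1+|v|²) for ‖v‖ ≤ N+1) ∧
  (defect ≤ C_g(1+|v|²)³ ∀ v)`;
* `AdjointEnskogTestFamilyRCut` — the EOS-window prefix of the route decl, then `AdjointEnskogTestFamilyRCutAt η₁`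
  (the restatement candidate K2R′);
* `adjointEnskogTestFamilyRCut_of_testFamilyR` (registered form `testFamilyRCut_of_testFamilyR`) — K2R as typed implies K2R′
  (sanity direction: the repair is a weakening).

The theorem file `EnskogAdjointDualityCollisionResidualVanishesCutDecides.lean` proves the repaired deciding theorem
`CollisionResidualVanishesDualCut → AdjointEnskogTestFamilyRCut → _root_.HydrodynamicLimit` (and with K1 as typed), and,
window by window, `AdjointEnskogTestFamilyRCutAt η₁ → (CollisionResidualVanishesDualCutAt η₁ ↔ HydroLimitInBandAt η₁)`.
References: H. Spohn, Large Scale Dynamics of Interacting Particles (1991), Part I Ch. 3 §3.2 [Spohn1991];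
M. Pulvirenti, S. Simonella, arXiv:1504.03215, §2 [PulvirentiSimonella2016]; R. E. Caflisch, Comm. Pure Appl. Math. 33
(1980) [Caflisch1980]. prover-line-stmt-AtomisticToContinuum-14658-c7-0 (line lead, cycle 7).
-/

noncomputable section

open MeasureTheory Set Filter Topology Function

namespace Summit.AtomisticToContinuum.HydrodynamicLimit.Theorems

open Literature.Analysis.FluidPDE Literature.MathematicalPhysics.KineticTheory
  Literature.Analysis.FunctionSpaces

/-- restatement candidate for the sibling crux AdjointEnskogTestFamilyR (stmt-AtomisticToContinuum-11592) filed in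
support of the crux CollisionResidualVanishes (stmt-AtomisticToContinuum-14658) — route-internal, not a cited fact.
**K2R′ at EOS window `η₁`: the backward linearised-Enskog test family with the velocity-cutoff defect bound.** Verbatim the
body of the route decl `AdjointEnskogTestFamilyR` after its EOS-window prefix (`∃ σ₀ > 0, ∀ σ < σ₀`, every classical hs-Euler
solution on `[0,T)`, every `t ∈ (0,T)` with packing `ρ_s(x)σ³ < η₁` on `[0,t] × 𝕋³`, every smooth `χ` and constants
`a, e, b`: an ADMISSIBLE family `(c^N, κ^N)` with (i) terminal data `χ(a + b·v + e|v|²/2)`, (iv) `c^N(0,·) → c₀` uniformly,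
(v) the Enskog defect of the Euler local Maxwellian tested on the family `→ 0`), EXCEPT clause (ii)∧(iii), which is in
cutoff form: `∃ η_N → 0, ∃ C_g, ∀ᶠ N`, `C¹` along free flight on `[0,t]`, `|Dφ^N + L^Nφ^N| ≤ η_N(1+|v|²)` for
`‖v‖ ≤ N + 1`, and `|Dφ^N + L^Nφ^N| ≤ C_g(1+|v|²)³` for all `v` (repair R1 of
`Cruxes/AdjointEnskogTestFamilyR/HyperVelocityObstruction.md` §9; same syntax as the premise of
`CollisionResidualVanishesDualCutAt`). -/
def AdjointEnskogTestFamilyRCutAt (η₁ : ℝ) : Prop :=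
    ∃ σ₀ : ℝ, 0 < σ₀ ∧ ∀ σ : ℝ, 0 < σ → σ < σ₀ → ∀ (T : ℝ) (ρ θ : ℝ → UnitAddTorus (Fin 3) → ℝ) (u : ℝ →
    UnitAddTorus (Fin 3) → EuclideanSpace ℝ (Fin 3)),
    Literature.MathematicalPhysics.KineticTheory.IsHardSphereEulerSolution σ T ρ u θ → ∀ t ∈ Set.Ioo 0 T, (∀ s ∈
    Set.Icc 0 t, ∀ x, ρ s x * σ ^ 3 < η₁) → ∀ χ : UnitAddTorus (Fin 3) → ℝ,
    Literature.Analysis.FunctionSpaces.Torus.IsSmooth χ → ∀ (a e : ℝ) (b : EuclideanSpace ℝ (Fin 3)), ∃ (c : ℕ → ℝ →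
    UnitAddTorus (Fin 3) → ℝ × EuclideanSpace ℝ (Fin 3) × ℝ) (κ : ℕ → ℝ → UnitAddTorus (Fin 3) → EuclideanSpace ℝ
    (Fin 3) → ℝ), (∀ N, Continuous (Function.uncurry (c N))) ∧ (∀ N, Continuous (fun p : ℝ × UnitAddTorus (Fin 3) ×
    EuclideanSpace ℝ (Fin 3) => κ N p.1 p.2.1 p.2.2)) ∧ (∃ C : ℝ, ∀ N s x x' v v', ‖c N s x‖ ≤ C ∧ dist (c N s x) (c
    N s x') ≤ C * dist x x' ∧ |κ N s x v| ≤ C * (1 + ‖v‖ ^ 2) ∧ |κ N s x v - κ N s x' v'| ≤ C * (1 + ‖v‖ ^ 2 + ‖v'‖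
    ^ 2) * (dist x x' + ‖v - v'‖)) ∧ (
      let G := Literature.Analysis.FluidPDE.Torus.geometry (Fin 3);
      let ε := fun N : ℕ => Literature.MathematicalPhysics.KineticTheory.hsDiameter σ N;
      let lam := fun N : ℕ => (N : ℝ) * ε N ^ 2;
      let f := fun (s : ℝ) (x : UnitAddTorus (Fin 3)) (v : EuclideanSpace ℝ (Fin 3)) => ρ s x *
          Literature.Analysis.FluidPDE.localMaxwellian 1 (θ s x) (u s x) v;
      let Y := fun η : ℝ => 3 / (2 * Real.pi) * deriv
          Literature.MathematicalPhysics.KineticTheory.hsExcessFreeEnergy η;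
      let φ := fun (N : ℕ) (s : ℝ) (x : UnitAddTorus (Fin 3)) (v : EuclideanSpace ℝ (Fin 3)) => (c N s x).1 + inner
          ℝ (c N s x).2.1 v + (c N s x).2.2 * ‖v‖ ^ 2 / 2 + (lam N)⁻¹ * κ N s x v;
      let L := fun (N : ℕ) (s : ℝ) (x : UnitAddTorus (Fin 3)) (v : EuclideanSpace ℝ (Fin 3)) => lam N * ∫ ω :
          Metric.sphere (0 : EuclideanSpace ℝ (Fin 3)) 1, (let y := G.translate x (ε N • (ω : EuclideanSpace ℝ (Fin
          3))); ∫ w : EuclideanSpace ℝ (Fin 3), max (inner ℝ (v - w) ω) 0 * Y (σ ^ 3 * ρ s (G.translate x ((ε N / 2) •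
          (ω : EuclideanSpace ℝ (Fin 3))))) * f s y w * (φ N s x (v - inner ℝ (v - w) ω • (ω : EuclideanSpace ℝ (Fin
          3))) + φ N s y (w + inner ℝ (v - w) ω • (ω : EuclideanSpace ℝ (Fin 3))) - φ N s x v - φ N s y w))
          ∂Literature.MathematicalPhysics.KineticTheory.sphereMeasure;
      (∀ N x v, φ N t x v = χ x * (a + inner ℝ b v + e * ‖v‖ ^ 2 / 2)) ∧ (∃ η : ℕ → ℝ, Filter.Tendsto η Filter.atTop
        (nhds 0) ∧ ∃ Cg : ℝ, ∀ᶠ N in Filter.atTop, (∀ x v, ContDiffOn ℝ 1 (fun r => φ N r (G.translate x (r • v)) v)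
        (Set.Icc 0 t)) ∧ (∀ s ∈ Set.Icc 0 t, ∀ x v, ‖v‖ ≤ (N : ℝ) + 1 → |derivWithin (fun r => φ N r (G.translate x
        ((r - s) • v)) v) (Set.Icc 0 t) s + L N s x v| ≤ η N * (1 + ‖v‖ ^ 2)) ∧ (∀ s ∈ Set.Icc 0 t, ∀ x v,
        |derivWithin (fun r => φ N r (G.translate x ((r - s) • v)) v) (Set.Icc 0 t) s + L N s x v| ≤ Cg * (1 + ‖v‖ ^
        2) ^ 3)) ∧ (∃ c₀ : UnitAddTorus (Fin 3) → ℝ × EuclideanSpace ℝ (Fin 3) × ℝ, Continuous c₀ ∧ ∀ δ : ℝ, 0 < δ →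
        ∀ᶠ N in Filter.atTop, ∀ x, dist (c N 0 x) (c₀ x) ≤ δ) ∧ Filter.Tendsto (fun N : ℕ => (∫ x : UnitAddTorus (Fin
        3), ∫ v : EuclideanSpace ℝ (Fin 3), f t x v * φ N t x v) - (∫ x : UnitAddTorus (Fin 3), ∫ v : EuclideanSpace ℝ
        (Fin 3), f 0 x v * φ N 0 x v) - ∫ s in Set.Icc 0 t, ∫ x : UnitAddTorus (Fin 3), ∫ v : EuclideanSpace ℝ (Fin
        3), f s x v * (derivWithin (fun r => φ N r (G.translate x ((r - s) • v)) v) (Set.Icc 0 t) s + (1 / 2 : ℝ) * L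
        N s x v)) Filter.atTop (nhds 0))

/-- restatement candidate for the sibling crux AdjointEnskogTestFamilyR (stmt-AtomisticToContinuum-11592) filed in
support of the crux CollisionResidualVanishes (stmt-AtomisticToContinuum-14658) — route-internal, not a cited fact.
**The cutoff repair K2R′**: the EOS-window prefix of the route decl `AdjointEnskogTestFamilyR` verbatim (`∀ η₁ > 0`, `f_ex`
analytic on `(0,η₁)` with `f_ex′ > 0` and `(ηZ)′ > 0`), then `AdjointEnskogTestFamilyRCutAt η₁`. -/
def AdjointEnskogTestFamilyRCut : Prop :=
  ∀ η₁ : ℝ, 0 < η₁ →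
    AnalyticOnNhd ℝ Literature.MathematicalPhysics.KineticTheory.hsExcessFreeEnergy (Set.Ioo 0 η₁) →
    (∀ η ∈ Set.Ioo 0 η₁, 0 < deriv Literature.MathematicalPhysics.KineticTheory.hsExcessFreeEnergy η) →
    (∀ η ∈ Set.Ioo 0 η₁, 0 < deriv (fun x : ℝ => x * Literature.MathematicalPhysics.KineticTheory.hsCompressibility x) η) →
    AdjointEnskogTestFamilyRCutAt η₁


/-- **K2R′ is a weakening of K2R as typed** (sanity direction): a family whose defect is bounded by `η_N(1+|v|²)` for ALL
`v` (clause (iii) of the route decl `AdjointEnskogTestFamilyR`) satisfies the cutoff clause with `C_g = 1` once `η_N ≤ 1`,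
everything else being verbatim. (The converse is the point of the repair: by the hyper-velocity obstruction no admissible
family satisfies the ∀`v` clause at a non-trivial datum, while the cutoff clause is the one the duality glue actually
consumes.) [cite: PulvirentiSimonella2016, §2] -/
theorem adjointEnskogTestFamilyRCut_of_testFamilyR
    (h : Summit.AtomisticToContinuum.HydrodynamicLimit.Theses.EnskogAdjointDuality.AdjointEnskogTestFamilyR) :
    AdjointEnskogTestFamilyRCut := by
  intro η₁ hη₁ hA hB hC
  obtain ⟨σ₀, hσ₀, H⟩ := h η₁ hη₁ hA hB hC
  refine ⟨σ₀, hσ₀, fun σ hσ hσlt T ρ θ u hEul t ht hg χ hχ a e b => ?_⟩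
  obtain ⟨c, κ, hc, hκ, hadm, hrest⟩ := H σ hσ hσlt T ρ θ u hEul t ht hg χ hχ a e b
  refine ⟨c, κ, hc, hκ, hadm, ?_⟩
  extract_lets G ε lam f Y φ L at hrest
  obtain ⟨h1, ⟨η, hη, hev⟩, h3, h4⟩ := hrest
  refine ⟨h1, ⟨η, hη, 1, ?_⟩, h3, h4⟩
  have hη1 : ∀ᶠ N in Filter.atTop, η N ≤ 1 := by
    have := (Metric.tendsto_nhds.1 hη) 1 one_pos
    exact this.mono fun N hN => by
      have h' : |η N| < 1 := by simpa [Real.dist_eq] using hN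
      exact (le_abs_self _).trans h'.le
  filter_upwards [hev, hη1] with N hN hN1
  obtain ⟨hC1, hdef⟩ := hN
  refine ⟨hC1, fun s hs x v _ => hdef s hs x v, fun s hs x v => (hdef s hs x v).trans ?_⟩
  have h1v : (1 : ℝ) ≤ 1 + ‖v‖ ^ 2 := by nlinarith [sq_nonneg ‖v‖]
  have hη0 : 0 ≤ η N := by
    have h0 := (abs_nonneg _).trans (hdef s hs x v)
    exact nonneg_of_mul_nonneg_left h0 (by positivity)
  calc η N * (1 + ‖v‖ ^ 2) ≤ 1 * (1 + ‖v‖ ^ 2) := mul_le_mul_of_nonneg_right hN1 (by positivity)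
    _ ≤ 1 * (1 + ‖v‖ ^ 2) ^ 3 := by
        rw [one_mul, one_mul]
        calc (1 + ‖v‖ ^ 2) = (1 + ‖v‖ ^ 2) ^ 1 := (pow_one _).symm
          _ ≤ (1 + ‖v‖ ^ 2) ^ 3 := pow_le_pow_right₀ h1v (by norm_num)

/-- **Registered form** (sub-goal `testFamilyRCut_of_testFamilyR` of the crux stmt-AtomisticToContinuum-14658, line `birth`): `adjointEnskogTestFamilyRCut_of_testFamilyR` as a closed implication — the sibling crux as typed implies its cutoff repair K2R′. [cite: PulvirentiSimonella2016, §2] -/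
theorem testFamilyRCut_of_testFamilyR : Summit.AtomisticToContinuum.HydrodynamicLimit.Theses.EnskogAdjointDuality.AdjointEnskogTestFamilyR → AdjointEnskogTestFamilyRCut :=
  adjointEnskogTestFamilyRCut_of_testFamilyR

end Summit.AtomisticToContinuum.HydrodynamicLimit.Theorems

end
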